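import Mathlib
import Literature.NumberTheory.Transcendental.KZCalculusProofs
import Literature.NumberTheory.Transcendental.KZLogCalculusProofs
import Literature.NumberTheory.Transcendental.KZSemialgebraicComplex
import Literature.NumberTheory.Transcendental.SemialgebraicMapsProofs
import Literature.NumberTheory.Transcendental.SemialgebraicLineDeriv
import Summits.KontsevichZagierPeriods.KontsevichZagierPeriods.Theorems.HyperbolicBlochOffTetraSectorKernelAbelFiveTermAux

/-!
# `OffTetraSectorKernel`, line `odd-hyperbolic-ladder`: the carriers of the spherical fan exist
(stub `stub_sphereFanExists`)

A registered existence stub of the crux `OffTetraSectorKernel`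
(stmt-KontsevichZagierPeriods-10557, route HyperbolicBloch), spherical rung 1 (Girard's theorem
inside the Kontsevich–Zagier calculus). In the stereographic chart of the unit sphere (area density
`4/(1 + x² + y²)²`) the great circle `|z − c|² = 1 + |c|²`, `c = (c₁, c₂)`, `R² = 1 + c₁² + c₂²`, is
rationally parametrised by `p(τ) = (c₁ + R(1 − τ²)/(1 + τ²), c₂ + 2Rτ/(1 + τ²))`, and the geodesic
fan from the south pole over the arc `p((τ₁, τ₂))` is the image of the rectangle
`W = (τ₁, τ₂) × (0, 1)` under `Φ(τ, λ) = λ · p(τ)`. This file proves that the three integral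
representations of the fan reduction EXIST:

* the rectangle `W` with the pulled-back density `4λJ/(1 + λ²P)²` (`J = p × p′`, `P = |p|²`) — a
  rational function whose denominators `1 + τ²` and `(1 + λ²P)²` never vanish, hence continuous on
  the plane and bounded on the bounded rectangle;
* the fan `Φ(W)` itself — `ℚ`-semialgebraic by the Tarski–Seidenberg image theorem
  (`IsSemialgebraicMapOn.isSemialgebraic_image_holds`), bounded as the continuous image of a
  bounded set, with the bounded density `4/(1 + x² + y²)²`;
* the arctangent carrier `[(τ₁, τ₂), 2/(1 + τ²)]`.

All three are instances of one principle (`abel_exists_rep_of_bounded`): a `ℚ`-semialgebraic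
function on a bounded `ℚ`-semialgebraic set which is the restriction of a continuous function on
the ambient space is absolutely integrable (it is bounded on the compact closure).

References: M. Kontsevich, D. Zagier, *Periods* (2001), §1.1; J. Bochnak, M. Coste, M.-F. Roy,
*Real Algebraic Geometry* (1998), §2.2 (Prop. 2.2.6, Prop. 2.2.7). No definitions are introduced.
-/

noncomputable section

open Set MeasureTheory
open Literature.NumberTheory.Transcendental Literature.ModelTheory.ExponentialFields

namespace Summit.KontsevichZagierPeriods.HyperbolicBloch.OffTetraSectorKernel

/-- **Continuous semialgebraic integrands on bounded semialgebraic sets are representations**: if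
`σ ⊆ ℝⁿ` is bounded and `ℚ`-semialgebraic and `f` is `ℚ`-semialgebraic on `σ` and continuous on
`ℝⁿ`, then `[σ, f]` is an integral representation — `f` is bounded on a compact ball containing
`σ`, so `abel_exists_rep_of_bounded` applies. [cite: KontsevichZagier2001, §1.1] -/
theorem sphereFan_exists_rep_of_continuous {n : ℕ} {σ : Set (Fin n → ℝ)} {f : (Fin n → ℝ) → ℝ}
    (hσ : IsSemialgebraic ℚ σ) (hbdd : Bornology.IsBounded σ) (hf : IsSemialgebraicFunOn ℚ σ f)
    (hcont : Continuous f) : ∃ r : KZ.IntegralRep n, r.domain = σ ∧ r.integrand = f := by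
  obtain ⟨ρ, hρ⟩ := hbdd.subset_closedBall 0
  obtain ⟨C, hC⟩ :=
    (isCompact_closedBall (0 : Fin n → ℝ) ρ).exists_bound_of_continuousOn hcont.continuousOn
  exact abel_exists_rep_of_bounded hσ hbdd hf (C := C) fun x hx => by
    have h := hC x (hρ hx)
    rwa [Real.norm_eq_abs] at h

/-- **STUB `stub_sphereFanExists`**: the three representations of the spherical fan reduction
EXIST — the rectangle `(τ₁, τ₂) × (0, 1)` with the pulled-back density `4λJ/(1 + λ²P)²`
(continuous rational integrand on a bounded semialgebraic box), the geodesic fan itself (the image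
of the rectangle under the semialgebraic map `Φ(τ, λ) = λ·p(τ)`, semialgebraic by Tarski–Seidenberg,
bounded, density `4/(1 + x² + y²)²`), and the arctangent carrier `[(τ₁, τ₂), 2/(1 + τ²)]`.
[cite: KontsevichZagier2001, §1.1] -/
theorem stub_sphereFanExists : ∀ (c₁ c₂ R τ₁ τ₂ : ℝ), IsAlgebraic ℚ c₁ → IsAlgebraic ℚ c₂ → IsAlgebraic ℚ R → IsAlgebraic ℚ τ₁ → IsAlgebraic ℚ τ₂ → 0 < R → R ^ 2 = 1 + c₁ ^ 2 + c₂ ^ 2 → τ₁ < τ₂ → (∃ W : KZ.IntegralRep 2, W.domain = {z | τ₁ < z 0 ∧ z 0 < τ₂ ∧ 0 < z 1 ∧ z 1 < 1} ∧ W.integrand = fun z => 4 * z 1 * ((c₁ + R * (1 - z 0 ^ 2) / (1 + z 0 ^ 2)) * (2 * R * (1 - z 0 ^ 2) / (1 + z 0 ^ 2) ^ 2) - (c₂ + 2 * R * z 0 / (1 + z 0 ^ 2)) * (-4 * R * z 0 / (1 + z 0 ^ 2) ^ 2)) / (1 + z 1 ^ 2 * ((c₁ + R * (1 - z 0 ^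 2) / (1 + z 0 ^ 2)) ^ 2 + (c₂ + 2 * R * z 0 / (1 + z 0 ^ 2)) ^ 2)) ^ 2) ∧ (∃ T : KZ.IntegralRep 2, T.domain = (fun z : Fin 2 → ℝ => ![z 1 * (c₁ + R * (1 - z 0 ^ 2) / (1 + z 0 ^ 2)), z 1 * (c₂ + 2 * R * z 0 / (1 + z 0 ^ 2))]) '' {z | τ₁ < z 0 ∧ z 0 < τ₂ ∧ 0 < z 1 ∧ z 1 < 1} ∧ T.integrand = fun p => 4 / (1 + p 0 ^ 2 + p 1 ^ 2) ^ 2) ∧ (∃ A : KZ.IntegralRep 1, A.domain = {q | τ₁ < q 0 ∧ q 0 < τ₂} ∧ A.integrand = fun q => 2 / (1 + q 0 ^ 2)) := by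
  intro c₁ c₂ R τ₁ τ₂ hc₁ hc₂ hR hτ₁ hτ₂ _hR0 _hRsq _hτ
  /- pointwise quotients of `ℚ`-semialgebraic functions (junk value `x/0 = 0` included) -/
  have hdiv : ∀ {m : ℕ} {s : Set (Fin m → ℝ)} {f g : (Fin m → ℝ) → ℝ},
      IsSemialgebraicFunOn ℚ s f → IsSemialgebraicFunOn ℚ s g →
      IsSemialgebraicFunOn ℚ s (fun x => f x / g x) :=
    fun hf hg => (hf.fun_mul hg.fun_inv).congr fun x _ => by simp [div_eq_mul_inv]
  /- the rectangle `σ = (τ₁, τ₂) × (0, 1)` -/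
  set σ : Set (Fin 2 → ℝ) := {z | τ₁ < z 0 ∧ z 0 < τ₂ ∧ 0 < z 1 ∧ z 1 < 1} with hσdef
  have hσ : IsSemialgebraic ℚ σ := abel_isSemialgebraic_rect hτ₁ hτ₂ isAlgebraic_zero isAlgebraic_one
  have hσbdd : Bornology.IsBounded σ := by
    refine abel_isBounded_of_abs_le (|τ₁| + |τ₂| + 1) ?_
    rintro z ⟨h1, h2, h3, h4⟩ i
    have ha := neg_abs_le τ₁
    have hb := le_abs_self τ₂
    have hc := abs_nonneg τ₁
    have hd := abs_nonneg τ₂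
    fin_cases i
    · exact abs_le.2 ⟨by simp; linarith, by simp; linarith⟩
    · exact abs_le.2 ⟨by simp; linarith, by simp; linarith⟩
  /- semialgebraic atoms on `σ` -/
  have x0 : IsSemialgebraicFunOn ℚ σ (fun z => z 0) := isSemialgebraicFunOn_apply hσ 0
  have x1 : IsSemialgebraicFunOn ℚ σ (fun z => z 1) := isSemialgebraicFunOn_apply hσ 1
  have k1 : IsSemialgebraicFunOn ℚ σ (fun _ => (1 : ℝ)) :=
    isSemialgebraicFunOn_const_of_isAlgebraic hσ isAlgebraic_one
  have k2 : IsSemialgebraicFunOn ℚ σ (fun _ => (2 : ℝ)) := isSemialgebraicFunOn_const_ofNat hσ 2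
  have k4 : IsSemialgebraicFunOn ℚ σ (fun _ => (4 : ℝ)) := isSemialgebraicFunOn_const_ofNat hσ 4
  have kc₁ : IsSemialgebraicFunOn ℚ σ (fun _ => c₁) := isSemialgebraicFunOn_const_of_isAlgebraic hσ hc₁
  have kc₂ : IsSemialgebraicFunOn ℚ σ (fun _ => c₂) := isSemialgebraicFunOn_const_of_isAlgebraic hσ hc₂
  have kR : IsSemialgebraicFunOn ℚ σ (fun _ => R) := isSemialgebraicFunOn_const_of_isAlgebraic hσ hR
  have hD : IsSemialgebraicFunOn ℚ σ (fun z => 1 + z 0 ^ 2) := k1.fun_add (x0.fun_pow 2)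
  have hN : IsSemialgebraicFunOn ℚ σ (fun z => 1 - z 0 ^ 2) := k1.fun_sub (x0.fun_pow 2)
  /- `p₁(τ) = c₁ + R(1−τ²)/(1+τ²)`, `p₂(τ) = c₂ + 2Rτ/(1+τ²)` and their derivatives -/
  have hA : IsSemialgebraicFunOn ℚ σ (fun z => c₁ + R * (1 - z 0 ^ 2) / (1 + z 0 ^ 2)) :=
    kc₁.fun_add (hdiv (kR.fun_mul hN) hD)
  have hA' : IsSemialgebraicFunOn ℚ σ (fun z => 2 * R * (1 - z 0 ^ 2) / (1 + z 0 ^ 2) ^ 2) :=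
    hdiv ((k2.fun_mul kR).fun_mul hN) (hD.fun_pow 2)
  have hB : IsSemialgebraicFunOn ℚ σ (fun z => c₂ + 2 * R * z 0 / (1 + z 0 ^ 2)) :=
    kc₂.fun_add (hdiv ((k2.fun_mul kR).fun_mul x0) hD)
  have hB' : IsSemialgebraicFunOn ℚ σ (fun z => -4 * R * z 0 / (1 + z 0 ^ 2) ^ 2) :=
    hdiv ((k4.fun_neg.fun_mul kR).fun_mul x0) (hD.fun_pow 2)
  refine ⟨?_, ?_, ?_⟩
  · /- (W) the rectangle with the pulled-back density -/
    refine sphereFan_exists_rep_of_continuous hσ hσbdd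
      (hdiv ((k4.fun_mul x1).fun_mul ((hA.fun_mul hA').fun_sub (hB.fun_mul hB')))
        ((k1.fun_add ((x1.fun_pow 2).fun_mul ((hA.fun_pow 2).fun_add (hB.fun_pow 2)))).fun_pow 2)) ?_
    fun_prop (disch := (intro x; positivity))
  · /- (T) the geodesic fan `Φ(σ)` -/
    set Φ : (Fin 2 → ℝ) → (Fin 2 → ℝ) := fun z =>
      ![z 1 * (c₁ + R * (1 - z 0 ^ 2) / (1 + z 0 ^ 2)), z 1 * (c₂ + 2 * R * z 0 / (1 + z 0 ^ 2))]
      with hΦdef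
    have hΦ0 : IsSemialgebraicFunOn ℚ σ (fun z => Φ z 0) :=
      (x1.fun_mul hA).congr fun z _ => by simp [hΦdef]
    have hΦ1 : IsSemialgebraicFunOn ℚ σ (fun z => Φ z 1) :=
      (x1.fun_mul hB).congr fun z _ => by simp [hΦdef]
    have hΦ : IsSemialgebraicMapOn ℚ σ Φ :=
      IsSemialgebraicMapOn.of_forall hσ (Fin.forall_fin_two.2 ⟨hΦ0, hΦ1⟩)
    have hT : IsSemialgebraic ℚ (Φ '' σ) :=
      IsSemialgebraicMapOn.isSemialgebraic_image_holds hΦ Subset.rfl hσ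
    have hΦc : Continuous Φ := by
      refine continuous_pi (Fin.forall_fin_two.2 ⟨?_, ?_⟩)
      · simp only [hΦdef, Matrix.cons_val_zero]
        fun_prop (disch := (intro x; positivity))
      · simp only [hΦdef, Matrix.cons_val_one]
        fun_prop (disch := (intro x; positivity))
    have hTbdd : Bornology.IsBounded (Φ '' σ) := by
      obtain ⟨ρ, hρ⟩ := hσbdd.subset_closedBall 0
      exact ((isCompact_closedBall _ _).image hΦc).isBounded.subset (image_mono hρ)
    have y0 : IsSemialgebraicFunOn ℚ (Φ '' σ) (fun p => p 0) := isSemialgebraicFunOn_apply hT 0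
    have y1 : IsSemialgebraicFunOn ℚ (Φ '' σ) (fun p => p 1) := isSemialgebraicFunOn_apply hT 1
    have l1 : IsSemialgebraicFunOn ℚ (Φ '' σ) (fun _ => (1 : ℝ)) :=
      isSemialgebraicFunOn_const_of_isAlgebraic hT isAlgebraic_one
    have l4 : IsSemialgebraicFunOn ℚ (Φ '' σ) (fun _ => (4 : ℝ)) := isSemialgebraicFunOn_const_ofNat hT 4
    refine sphereFan_exists_rep_of_continuous hT hTbdd
      (hdiv l4 (((l1.fun_add (y0.fun_pow 2)).fun_add (y1.fun_pow 2)).fun_pow 2)) ?_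
    fun_prop (disch := (intro x; positivity))
  · /- (A) the arctangent carrier on `(τ₁, τ₂)` -/
    have hι : IsSemialgebraic ℚ {q : Fin 1 → ℝ | τ₁ < q 0 ∧ q 0 < τ₂} := isSemialgebraic_logIvl hτ₁ hτ₂
    have q0 : IsSemialgebraicFunOn ℚ {q : Fin 1 → ℝ | τ₁ < q 0 ∧ q 0 < τ₂} (fun q => q 0) :=
      isSemialgebraicFunOn_apply hι 0
    have m1 : IsSemialgebraicFunOn ℚ {q : Fin 1 → ℝ | τ₁ < q 0 ∧ q 0 < τ₂} (fun _ => (1 : ℝ)) :=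
      isSemialgebraicFunOn_const_of_isAlgebraic hι isAlgebraic_one
    have m2 : IsSemialgebraicFunOn ℚ {q : Fin 1 → ℝ | τ₁ < q 0 ∧ q 0 < τ₂} (fun _ => (2 : ℝ)) :=
      isSemialgebraicFunOn_const_ofNat hι 2
    refine sphereFan_exists_rep_of_continuous hι (abel_isBounded_Ioo1 τ₁ τ₂)
      (hdiv m2 (m1.fun_add (q0.fun_pow 2))) ?_
    fun_prop (disch := (intro x; positivity))

end Summit.KontsevichZagierPeriods.HyperbolicBloch.OffTetraSectorKernel

end
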